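import Literature.Probability.RandomPlanarGeometry.SAWCountZdBadWalkLoops
import Literature.Probability.RandomPlanarGeometry.SAWPulledLargeForceExpansionZdFourthSymbolCensus
import Literature.Probability.RandomPlanarGeometry.SAWPulledLargeForceExpansionZdWordTypes
import HarnessLib

/-!
# The bad-walk classes by AXIS TYPE: `G_n(u) = u! × #{canonical bad words}`, and the census law (L1) as a count of canonical words

Topic `Literature/Probability/RandomPlanarGeometry` (joins `SAWCountZdBadWalkLoops.lean` — `card_badClass_eq_card_badWords`: the class `G_n(u)` of
non-self-avoiding memory-2 walks of `ℤ^u` using every axis is a count of reversal-free step words with two equal partial sums and every axis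
occurring —, `SAWPulledLargeForceExpansionZdWordTypes.lean` (a-p3 g18: axis types of words, `SameType`, the canonical representative `canon`,
`numAxes`, ★ `card_filter_sameType : #class = d^{(numAxes)}`) and `SAWPulledLargeForceExpansionZdFourthSymbolCensus.lean` (a-p1 g20: (L1) at `n`
and Am. BC for every `k` from the COUNT `G_n(n−3) = (n−3)!·2^{n−3}(n³−9n²+29n−40)`); `Percolation.DualContours`: `wordPos`, `stepVec`).

PRINTED CONTEXT (locators only; nothing is quoted digit-for-digit). Madras–Slade (1993) Definition 1.2.4 and §1.1 eq. (1.1.8) p. 5. NOT IN PRINT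
(lane statements): everything below.

THIS FILE (lane «pcv-sawmu», a-p1 g20; all PROVED, standard axioms, NO definitions):
* `WordTypes.sum_stepVec_eq_zero_iff` (a block of unit steps sums to zero iff every axis is balanced on it), `WordTypes.wordPos_eq_add_sum_block`,
  ★ `WordTypes.SameType.sum_stepVec_eq_zero_iff` / ★ `WordTypes.SameType.wordPos_eq_iff` (REPEATS ARE DECIDED BY THE TYPE), `WordTypes.SameType.noRev_iff`,
  `WordTypes.numAxes_eq_card_image`, ★ `WordTypes.forall_exists_axis_iff_numAxes_eq`;
* ★★★ `WordTypes.card_badWords_eq_factorial_mul_card_canonical` — the bad words of length `n` over `u` axes (reversal-free, a repeat, every axis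
  occurring) number `u!` × the CANONICAL such words (`canon τ = τ`, `numAxes τ = u`): every condition is type-invariant and each type class with `u`
  axes has `u^{(u)} = u!` members;
* ★★★ `card_badClass_eq_factorial_mul_card_canonical` — `G_n(u) = u! · #{τ : Word n n | canon τ = τ, numAxes τ = u, reversal-free, a repeat}`;
* ★★★ `exists_polynomial_count_topFour_of_card_canonical` — the census law (L1) at `n = l + 3` from ONE count of canonical words:
  `#{…} = 2^l·(n³ − 9n² + 29n − 40)`; ★★★ `exists_polynomial_largeForceCoeffZd_thirdCoeff_of_word_and_bridge_counts` — Am. BC's law for every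
  `k ≥ 3` from that word count (all `n ≥ 5`) and the span-two second-class bridge count (all `c ≥ 4`).
SO THE (L1) CAR IS NOW A STATEMENT ABOUT FINITE WORDS: with signs not normalised the lane's five loop-signature classes give
`2^{n−3}·[4(n−4)² + (n−5)²(n−3) + (n−4) + (n−5) + 4(n−5)]` canonical bad words (DESIGN-ZD-CENSUS-LAW-L1 §2b, enumerator-verified `n ≤ 10`).
[cite: MadrasSlade1993, Definition 1.2.4; §1.1 eq. (1.1.8) p. 5; §1.2 p. 10]

Provenance: lane «pcv-sawmu», a-p1 g20 (2026-08-27).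
-/

noncomputable section

open Finset
open scoped BigOperators
open Literature.Probability.LatticeModels
open Literature.Probability.RandomPlanarGeometry.SAW
open Literature.Probability.Percolation

namespace Literature.Probability.RandomPlanarGeometry.SAW.Zd

namespace WordTypes

variable {n d d' : ℕ}

/-! ### Block sums of step words are decided by the axis type -/

/-- A sum of unit steps vanishes iff every axis is balanced on the block: as many `+e_x` as `−e_x`.
[cite: MadrasSlade1993, Definition 1.2.4; lane lemma] -/
theorem sum_stepVec_eq_zero_iff (t : Finset (Fin n)) (w : Word n d) :
    ∑ p ∈ t, stepVec (w p) = (0 : Site d) ↔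
      ∀ x : Fin d, ((t.filter fun p => w p = (x, true)).card : ℤ) = (t.filter fun p => w p = (x, false)).card := by
  classical
  have hcoord : ∀ x : Fin d, (∑ p ∈ t, stepVec (w p)) x =
      ((t.filter fun p => w p = (x, true)).card : ℤ) - (t.filter fun p => w p = (x, false)).card := by
    intro x
    rw [Finset.sum_apply, Finset.card_filter, Finset.card_filter, Nat.cast_sum, Nat.cast_sum, ← Finset.sum_sub_distrib]
    refine Finset.sum_congr rfl fun p _ => ?_
    rcases hw : w p with ⟨a, b⟩
    by_cases hx : x = a
    · subst hx; cases b <;> simp [stepVec]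
    · have h1 : ¬ ((a, b) = (x, true)) := fun h => hx (Prod.mk.inj h).1.symm
      have h2 : ¬ ((a, b) = (x, false)) := fun h => hx (Prod.mk.inj h).1.symm
      cases b <;> simp [stepVec, hx, h1, h2]
  constructor
  · intro h x
    have := hcoord x
    rw [h, Pi.zero_apply] at this
    linarith
  · intro h
    funext x
    rw [hcoord x, h x, sub_self, Pi.zero_apply]

/-- The trace increment over a block: `wordPos w j = wordPos w i + Σ_{i ≤ p < j} stepVec (w p)` (`i ≤ j ≤ n`).
[cite: MadrasSlade1993, §1.1 (p. 1); lane plumbing] -/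
theorem wordPos_eq_add_sum_block (w : Word n d) {i j : ℕ} (hij : i ≤ j) (hj : j ≤ n) :
    wordPos w j = wordPos w i + ∑ p ∈ Finset.univ.filter (fun p : Fin n => i ≤ p.val ∧ p.val < j), stepVec (w p) := by
  classical
  induction j, hij using Nat.le_induction with
  | base =>
    rw [Finset.filter_eq_empty_iff.2 (fun p _ h => absurd h.1 (by omega)), Finset.sum_empty, add_zero]
  | succ j hij ih =>
    rw [wordPos_succ w (show j < n by omega), ih (by omega)]
    have hsplit : Finset.univ.filter (fun p : Fin n => i ≤ p.val ∧ p.val < j + 1) =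
        insert ⟨j, by omega⟩ (Finset.univ.filter fun p : Fin n => i ≤ p.val ∧ p.val < j) := by
      ext p
      simp only [Finset.mem_filter, Finset.mem_univ, true_and, Finset.mem_insert, Fin.ext_iff]
      omega
    rw [hsplit, Finset.sum_insert (by simp), add_comm (stepVec _), add_assoc]

/-- Same-type words have the same balanced blocks. [cite: MadrasSlade1993, Definition 1.2.4; lane lemma] -/
theorem SameType.sum_stepVec_eq_zero_iff {w : Word n d} {w' : Word n d'} (h : SameType w w') (t : Finset (Fin n)) :
    ∑ p ∈ t, stepVec (w p) = (0 : Site d) ↔ ∑ p ∈ t, stepVec (w' p) = (0 : Site d') := by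
  classical
  -- the balance condition, axis by axis of positions in `t`
  have key : ∀ {e e' : ℕ} {v : Word n e} {v' : Word n e'}, SameType v v' →
      (∀ x : Fin e, ((t.filter fun p => v p = (x, true)).card : ℤ) = (t.filter fun p => v p = (x, false)).card) →
      ∀ x' : Fin e', ((t.filter fun p => v' p = (x', true)).card : ℤ) = (t.filter fun p => v' p = (x', false)).card := by
    intro e e' v v' hvv hbal x'
    by_cases hocc : ∃ q ∈ t, (v' q).1 = x'
    · obtain ⟨q, hq, hqx⟩ := hocc
      have hb := hbal (v q).1
      -- the positions of axis `x'` in `v'` are the positions of axis `(v q).1` in `v`, with the same signs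
      have e1 : (t.filter fun p => v' p = (x', true)) = t.filter fun p => v p = ((v q).1, true) := by
        refine Finset.filter_congr fun p _ => ?_
        rw [Prod.ext_iff, Prod.ext_iff, ← hqx, ← (hvv.1 p q), hvv.2 p]
      have e2 : (t.filter fun p => v' p = (x', false)) = t.filter fun p => v p = ((v q).1, false) := by
        refine Finset.filter_congr fun p _ => ?_
        rw [Prod.ext_iff, Prod.ext_iff, ← hqx, ← (hvv.1 p q), hvv.2 p]
      rw [e1, e2, hb]
    · have e1 : (t.filter fun p => v' p = (x', true)) = ∅ :=
        Finset.filter_eq_empty_iff.2 fun p hp hpx => hocc ⟨p, hp, by rw [hpx]⟩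
      have e2 : (t.filter fun p => v' p = (x', false)) = ∅ :=
        Finset.filter_eq_empty_iff.2 fun p hp hpx => hocc ⟨p, hp, by rw [hpx]⟩
      rw [e1, e2]
  rw [WordTypes.sum_stepVec_eq_zero_iff, WordTypes.sum_stepVec_eq_zero_iff]
  exact ⟨key h, key h.symm⟩

/-- ★ REPEATS ARE DECIDED BY THE TYPE: same-type words have equal partial sums at the same pairs of times.
[cite: MadrasSlade1993, Definition 1.2.4; lane lemma] -/
theorem SameType.wordPos_eq_iff {w : Word n d} {w' : Word n d'} (h : SameType w w') {i j : ℕ} (hij : i ≤ j) (hj : j ≤ n) :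
    wordPos w i = wordPos w j ↔ wordPos w' i = wordPos w' j := by
  rw [wordPos_eq_add_sum_block w hij hj, wordPos_eq_add_sum_block w' hij hj]
  constructor
  · intro heq
    have := (h.sum_stepVec_eq_zero_iff _).1 (by rw [left_eq_add] at heq; exact heq)
    rw [this, add_zero]
  · intro heq
    have := (h.sum_stepVec_eq_zero_iff _).2 (by rw [left_eq_add] at heq; exact heq)
    rw [this, add_zero]

/-- Immediate reversals are decided by the type. [cite: MadrasSlade1993, Definition 1.2.4; lane plumbing] -/
theorem SameType.noRev_iff {w : Word n d} {w' : Word n d'} (h : SameType w w') :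
    (∀ p : Fin n, ∀ hp : p.val + 1 < n, w ⟨p.val + 1, hp⟩ ≠ ((w p).1, !(w p).2)) ↔
      ∀ p : Fin n, ∀ hp : p.val + 1 < n, w' ⟨p.val + 1, hp⟩ ≠ ((w' p).1, !(w' p).2) := by
  have key : ∀ {e e' : ℕ} {v : Word n e} {v' : Word n e'}, SameType v v' →
      ∀ p : Fin n, ∀ hp : p.val + 1 < n, v' ⟨p.val + 1, hp⟩ = ((v' p).1, !(v' p).2) → v ⟨p.val + 1, hp⟩ = ((v p).1, !(v p).2) := by
    intro e e' v v' hvv p hp hrev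
    rw [Prod.ext_iff] at hrev ⊢
    exact ⟨(hvv.1 _ _).2 hrev.1, by rw [hvv.2, hvv.2 p]; exact hrev.2⟩
  exact ⟨fun H p hp hrev => H p hp (key h p hp hrev), fun H p hp hrev => H p hp (key h.symm p hp hrev)⟩

/-! ### The number of axes -/

/-- `numAxes w` is the number of distinct axes occurring in `w`. [cite: MadrasSlade1993, Definition 1.2.4; lane plumbing] -/
theorem numAxes_eq_card_image (w : Word n d) : numAxes w = (Finset.univ.image fun p : Fin n => (w p).1).card := by
  classical
  unfold numAxes
  refine Finset.card_bij (fun p _ => (w p).1) (fun p _ => Finset.mem_image_of_mem _ (Finset.mem_univ _)) ?_ ?_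
  · intro p hp q hq hpq
    exact (Finset.mem_filter.1 hp).2.eq_of_axis_eq (Finset.mem_filter.1 hq).2 hpq
  · intro a ha
    obtain ⟨p, -, rfl⟩ := Finset.mem_image.1 ha
    exact ⟨firstOcc w p, Finset.mem_filter.2 ⟨Finset.mem_univ _, isFirst_firstOcc w p⟩, axis_firstOcc w p⟩

/-- Every axis of `Fin d` occurs in `w` iff `numAxes w = d`. [cite: MadrasSlade1993, Definition 1.2.4; lane lemma] -/
theorem forall_exists_axis_iff_numAxes_eq (w : Word n d) : (∀ a : Fin d, ∃ p : Fin n, (w p).1 = a) ↔ numAxes w = d := by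
  classical
  rw [numAxes_eq_card_image]
  constructor
  · intro h
    have : (Finset.univ.image fun p : Fin n => (w p).1) = Finset.univ := by
      ext a
      simp only [Finset.mem_image, Finset.mem_univ, true_and, iff_true]
      obtain ⟨p, hp⟩ := h a
      exact ⟨p, hp⟩
    rw [this, Finset.card_univ, Fintype.card_fin]
  · intro h a
    have hsub : (Finset.univ.image fun p : Fin n => (w p).1) = Finset.univ :=
      Finset.eq_univ_of_card _ (by rw [h, Fintype.card_fin])
    have : a ∈ Finset.univ.image fun p : Fin n => (w p).1 := by rw [hsub]; exact Finset.mem_univ a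
    obtain ⟨p, -, hp⟩ := Finset.mem_image.1 this
    exact ⟨p, hp⟩

/-! ### Counting by types: `u!` times the canonical words -/

open Classical in
/-- ★★★ THE BAD WORDS BY TYPE: the reversal-free step words of length `n` over `u` axes with two equal partial sums in which every axis
occurs number `u!` times the CANONICAL such words (`canon τ = τ`, `numAxes τ = u`; canonical = axes named by rank of first occurrence,
`WordTypes.canon`) — each type class with `u` axes has `u!` members in dimension `u` (`card_filter_sameType`), and all three conditions are
decided by the type. [cite: MadrasSlade1993, Definition 1.2.4; §1.1 eq. (1.1.8) p. 5; lane theorem] -/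
theorem card_badWords_eq_factorial_mul_card_canonical (n u : ℕ) :
    (Finset.univ.filter fun w : Word n u =>
        (∀ p : Fin n, ∀ hp : p.val + 1 < n, w ⟨p.val + 1, hp⟩ ≠ ((w p).1, !(w p).2)) ∧
        (∃ i ≤ n, ∃ j ≤ n, i < j ∧ wordPos w i = wordPos w j) ∧ ∀ a : Fin u, ∃ p : Fin n, (w p).1 = a).card =
      u.factorial * (Finset.univ.filter fun τ : Word n n => canon τ = τ ∧ numAxes τ = u ∧
        (∀ p : Fin n, ∀ hp : p.val + 1 < n, τ ⟨p.val + 1, hp⟩ ≠ ((τ p).1, !(τ p).2)) ∧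
        (∃ i ≤ n, ∃ j ≤ n, i < j ∧ wordPos τ i = wordPos τ j)).card := by
  set S := Finset.univ.filter fun w : Word n u =>
        (∀ p : Fin n, ∀ hp : p.val + 1 < n, w ⟨p.val + 1, hp⟩ ≠ ((w p).1, !(w p).2)) ∧
        (∃ i ≤ n, ∃ j ≤ n, i < j ∧ wordPos w i = wordPos w j) ∧ ∀ a : Fin u, ∃ p : Fin n, (w p).1 = a with hS
  set T := Finset.univ.filter fun τ : Word n n => canon τ = τ ∧ numAxes τ = u ∧
        (∀ p : Fin n, ∀ hp : p.val + 1 < n, τ ⟨p.val + 1, hp⟩ ≠ ((τ p).1, !(τ p).2)) ∧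
        (∃ i ≤ n, ∃ j ≤ n, i < j ∧ wordPos τ i = wordPos τ j) with hT
  -- `canon` maps `S` into `T`
  have hmaps : ∀ w ∈ S, canon w ∈ T := by
    intro w hw
    obtain ⟨hrev, ⟨i, hi, j, hj, hij, heq⟩, hall⟩ := (Finset.mem_filter.1 hw).2
    have hty := sameType_canon w
    refine Finset.mem_filter.2 ⟨Finset.mem_univ _, hty.canon_eq.symm, ?_, ?_, ⟨i, hi, j, hj, hij, ?_⟩⟩
    · rw [numAxes_canon, ← forall_exists_axis_iff_numAxes_eq]; exact hall
    · exact hty.noRev_iff.1 hrev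
    · exact (hty.wordPos_eq_iff hij.le hj).1 heq
  rw [Finset.card_eq_sum_card_fiberwise hmaps]
  -- each fibre is a full type class of size `u!`
  have hfib : ∀ τ ∈ T, (S.filter fun w => canon w = τ).card = u.factorial := by
    intro τ hτ
    obtain ⟨hcan, hnum, hrev, ⟨i, hi, j, hj, hij, heq⟩⟩ := (Finset.mem_filter.1 hτ).2
    have hclass : (S.filter fun w => canon w = τ) = Finset.univ.filter fun w : Word n u => SameType w τ := by
      ext w
      simp only [hS, Finset.mem_filter, Finset.mem_univ, true_and]
      constructor
      · rintro ⟨-, hw⟩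
        exact sameType_of_canon_eq (hw.trans hcan.symm)
      · intro hty
        have hcw : canon w = τ := hty.canon_eq.trans hcan
        refine ⟨⟨hty.noRev_iff.2 hrev, ⟨i, hi, j, hj, hij, (hty.wordPos_eq_iff hij.le hj).2 heq⟩, ?_⟩, hcw⟩
        rw [forall_exists_axis_iff_numAxes_eq]
        exact hty.numAxes_eq.trans hnum
    rw [hclass, card_filter_sameType, hnum, Nat.descFactorial_self]
  rw [Finset.sum_congr rfl hfib, Finset.sum_const, smul_eq_mul, mul_comm]

end WordTypes

section Assembly

open WordTypes

open Classical in
/-- ★★★ `G_n(u) = u! × #{canonical bad words}`: the non-self-avoiding memory-2 walks of length `n` on `ℤ^u` stepping on every axis (the inline class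
of `SAWCountZdTopCoefficients.memCount_two_eq_count_add_sum_choose`, the hypothesis of `exists_polynomial_count_topFour_of_card_badClass`) number `u!`
times the canonical reversal-free words of length `n` with `u` axes and two equal partial sums. [cite: MadrasSlade1993, Definition 1.2.4; §1.2 p. 10; lane theorem] -/
theorem card_badClass_eq_factorial_mul_card_canonical (u n : ℕ) :
    ((memWalks u 2 n).filter fun (ω : ℕ → Site u) =>
        (∃ i ≤ n, ∃ j ≤ n, i < j ∧ ω i = ω j) ∧ ∀ a : Fin u, ∃ i ≤ n, ω i a ≠ (0 : ℤ)).card =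
      u.factorial * (Finset.univ.filter fun τ : Word n n => canon τ = τ ∧ numAxes τ = u ∧
        (∀ p : Fin n, ∀ hp : p.val + 1 < n, τ ⟨p.val + 1, hp⟩ ≠ ((τ p).1, !(τ p).2)) ∧
        (∃ i ≤ n, ∃ j ≤ n, i < j ∧ wordPos τ i = wordPos τ j)).card := by
  rw [card_badClass_eq_card_badWords, card_badWords_eq_factorial_mul_card_canonical]

open Classical in
/-- ★★★ THE CENSUS LAW (L1) FROM ONE COUNT OF CANONICAL WORDS: for `n = l + 3`, IF the canonical reversal-free words of length `n` with `n − 3` axes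
and a repeat number `2^{n−3}·(n³ − 9n² + 29n − 40)`, THEN `d ↦ c_n(ℤ^d)` has the top three coefficients of `SAWCountZdThirdCoefficient` and
`48·[d^{n−3}] c_n(ℤ^d) = −2^n(n³ − 12n² + 59n − 138)`. [cite: MadrasSlade1993, §1.1 eq. (1.1.8) p. 5; lane theorem] -/
theorem exists_polynomial_count_topFour_of_card_canonical (l : ℕ)
    (hT : ((Finset.univ.filter fun τ : Word (l + 3) (l + 3) => canon τ = τ ∧ numAxes τ = l ∧
        (∀ p : Fin (l + 3), ∀ hp : p.val + 1 < l + 3, τ ⟨p.val + 1, hp⟩ ≠ ((τ p).1, !(τ p).2)) ∧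
        (∃ i ≤ l + 3, ∃ j ≤ l + 3, i < j ∧ wordPos τ i = wordPos τ j)).card : ℚ) =
      2 ^ l * (((l : ℚ) + 3) ^ 3 - 9 * ((l : ℚ) + 3) ^ 2 + 29 * ((l : ℚ) + 3) - 40)) :
    ∃ P : Polynomial ℚ, P.natDegree ≤ l + 3 ∧ P.coeff (l + 3) = (2 : ℚ) ^ (l + 3) ∧
      P.coeff (l + 2) = -(((l + 3 : ℕ) : ℚ) - 1) * 2 ^ (l + 2) ∧
      P.coeff (l + 1) = 2 ^ l * (((l + 3 : ℕ) : ℚ) ^ 2 - 5 * ((l + 3 : ℕ) : ℚ) + 8) ∧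
      48 * P.coeff l = -(2 : ℚ) ^ (l + 3) * (((l + 3 : ℕ) : ℚ) ^ 3 - 12 * ((l + 3 : ℕ) : ℚ) ^ 2 + 59 * ((l + 3 : ℕ) : ℚ) - 138) ∧
      ∀ d : ℕ, (count d (l + 3) : ℚ) = P.eval (d : ℚ) := by
  refine exists_polynomial_count_topFour_of_card_badClass l ?_
  rw [card_badClass_eq_factorial_mul_card_canonical, Nat.cast_mul, hT]
  ring

open Classical in
/-- ★★★ Am. BC's FOURTH-SYMBOL LAW FROM A WORD COUNT AND A BRIDGE COUNT: if for every `n ≥ 5` the canonical bad words number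
`2^{n−3}(n³ − 9n² + 29n − 40)` and for every `c ≥ 4` the second axis class of the span-two cell numbers `(c−3)!·2^{c−3}·(c⁵−12c⁴+59c³−162c²+276c−234)/6`,
then `[d^{k−3}] c_k^{(d)} = (−1)^{k−1}2^{k−3}(k−3)(k−4)(5k²−35k+56)/12` for every `k ≥ 3` (with the degree and the top two coefficients).
[cite: MadrasSlade1993, §1.1 eq. (1.1.8) p. 5; §4.2 eq. (4.2.20)–(4.2.22)] [cite: ClisbyLiangSlade2007, §1.3 eq. (1)/(3); lane theorem] -/
theorem exists_polynomial_largeForceCoeffZd_thirdCoeff_of_word_and_bridge_counts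
    (hT : ∀ l : ℕ, 2 ≤ l → ((Finset.univ.filter fun τ : Word (l + 3) (l + 3) => canon τ = τ ∧ numAxes τ = l ∧
        (∀ p : Fin (l + 3), ∀ hp : p.val + 1 < l + 3, τ ⟨p.val + 1, hp⟩ ≠ ((τ p).1, !(τ p).2)) ∧
        (∃ i ≤ l + 3, ∃ j ≤ l + 3, i < j ∧ wordPos τ i = wordPos τ j)).card : ℚ) =
      2 ^ l * (((l : ℚ) + 3) ^ 3 - 9 * ((l : ℚ) + 3) ^ 2 + 29 * ((l : ℚ) + 3) - 40))
    (hF : ∀ m : ℕ, 1 ≤ m → (((irreducibleBridges (m + 1) (m + 5)).filter fun (ω : ℕ → Site (m + 1)) => costZd m (m + 5) ω = m + 3 ∧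
        ∀ a : Fin (m + 1), a ≠ 0 → ∃ i ≤ m + 5, ω i a ≠ (0 : ℤ)).card : ℚ) =
      (m.factorial : ℚ) * 2 ^ m * ((((m : ℚ) + 3) ^ 5 - 12 * ((m : ℚ) + 3) ^ 4 + 59 * ((m : ℚ) + 3) ^ 3 - 162 * ((m : ℚ) + 3) ^ 2 +
        276 * ((m : ℚ) + 3) - 234) / 6))
    {k : ℕ} (hk : 3 ≤ k) :
    ∃ P : Polynomial ℚ, P.natDegree = k - 1 ∧ P.leadingCoeff = (-2 : ℚ) ^ (k - 1) ∧
      P.coeff (k - 2) = (-1 : ℚ) ^ (k - 1) * 2 ^ (k - 2) * ((k : ℚ) ^ 2 - 5 * k + 7) ∧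
      P.coeff (k - 3) = (-1 : ℚ) ^ (k - 1) * 2 ^ (k - 3) * (((k : ℚ) - 3) * ((k : ℚ) - 4) * (5 * (k : ℚ) ^ 2 - 35 * (k : ℚ) + 56)) / 12 ∧
      ∀ d : ℕ, (largeForceCoeffZd d k : ℚ) = P.eval (d : ℚ) := by
  refine exists_polynomial_largeForceCoeffZd_thirdCoeff_of_axisClass_counts (fun l hl => ?_) hF hk
  rw [card_badClass_eq_factorial_mul_card_canonical, Nat.cast_mul, hT l hl]
  ring

end Assembly

end Literature.Probability.RandomPlanarGeometry.SAW.Zd
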